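import Mathlib
import Summits.NavierStokesRegularity.NavierStokesRegularity.Theorems.PlaneEnergyCeilingPlanarEnergyAPrioriDecayDuhamel
import Summits.NavierStokesRegularity.NavierStokesRegularity.Theorems.PlaneEnergyCeilingPlanarEnergyAPrioriDecayHeat

/-!
# Route PlaneEnergyCeiling · crux `PlanarEnergyAPriori` — decay persistence, file 3:
# the velocity of a bounded finite-energy Oseen-mild field keeps the decay `(1 + ‖x‖)⁻⁴`

Helper file for the crux item stmt-NavierStokesRegularity-16855 (`PlanarEnergyAPriori`, route
`PlaneEnergyCeiling`), landed `--supports` that item, on the proof path of the registered stub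
`stub_decayPersistence` of the line `birth`. It runs the spatial-decay bootstrap of
Brandolese / Miyakawa along the Oseen integral equation (viscosity `1`)

  `v(τ) = e^{(τ-s)Δ} v(s) - B¹_s(v,v)(τ)`,   `0 < s < τ < T`,

for a field `v` that is jointly continuous and bounded (`‖v‖ ≤ M`) on `[0,T) × ℝ³`, has energy
`∫|v(τ)|² ≤ e`, and a datum with `|v(0,y)| ≤ A (1+|y|)⁻⁴`:

* `decay_window_step` — ONE TIME WINDOW `(s₀, s₁]` of parabolically small length
  (`2 C_B √(s₁-s₀) M ≤ 1/32`, `s₁ - s₀ ≤ 1`): if the free term from the base time decays like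
  `C_H A₀ (1+|x|)⁻⁴` (in the `ε`-form that also covers the base time `0`, where the Oseen
  identity is only available from positive base times), then `|v(τ,x)| ≤ 256 D (1+|x|)⁻⁴` on
  the window, `D = max M (2(C_H A₀ + 16 C_B e))`. Mechanism: dyadic induction
  `|x| ≥ 2^k ⇒ |v| ≤ D 16^{-k}` — far sources (`|y-x| ≥ |x|/2`) give `16 C_B e |x|⁻⁴` by the
  energy, near sources give `2C_B√(s₁-s₀) · M · D 16^{-k} ≤ (D/32) 16^{-k}` by the induction
  hypothesis (ONE factor bounded by `M`, so the smallness of the window does not depend on the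
  growing constants) — the near/far bound being `exists_norm_oseenDuhamel_le_far_add_near`;
* `exists_decay_velocity` — finitely many windows cover `[0,T']`, `T' < T`:
  `|v(τ,x)| ≤ A' (1+|x|)⁻⁴` on `[0,T'] × ℝ³` (the first window uses the continuity of the
  caloric term at the base time, `tendsto_heatExtension_sub_nhdsWithin_zero`, the later ones the
  identity itself; the free term decays by `exists_norm_heatExtension_le_of_decay`).

References: L. Brandolese, Math. Ann. 329 (2004) = arXiv:math/0403136, §2; T. Miyakawa,
Funkcial. Ekvac. 45 (2002); G. Koch, N. Nadirashvili, G. Seregin, V. Šverák, Acta Math. 203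
(2009), §3–4 (the Oseen formulation). All statements [folklore].
-/

noncomputable section

-- single-conjunct summit: `Summit.<Summit>.<Problem>` repeats the name by the D-0017 layout
set_option linter.dupNamespace false

namespace Summit.NavierStokesRegularity.NavierStokesRegularity.Theorems.PlanarEnergyAPriori

open MeasureTheory Set Filter Topology Function Metric Real
open scoped ENNReal NNReal
open Literature.Analysis.FluidPDE Literature.Analysis.UnboundedOperators

/-! ### Weight conversions -/

/-- `(1 + r)^{-4} = ((1 + r)^4)⁻¹` for `0 ≤ r`. [folklore] -/
theorem one_add_rpow_neg_four {r : ℝ} (hr : 0 ≤ r) : (1 + r) ^ (-(4 : ℝ)) = ((1 + r) ^ 4)⁻¹ := by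
  rw [Real.rpow_neg (by positivity), show (4 : ℝ) = ((4 : ℕ) : ℝ) by norm_num, Real.rpow_natCast]

/-- On the dyadic shell `2^k ≤ ‖x‖ < 2^{k+1}`: `(16^k)⁻¹ ≤ 256 ((1 + ‖x‖)^4)⁻¹`. [folklore] -/
theorem inv_sixteen_pow_le_of_norm_lt {x : EuclideanSpace ℝ (Fin 3)} {k : ℕ}
    (hx : ‖x‖ < 2 ^ (k + 1)) : ((16 : ℝ) ^ k)⁻¹ ≤ 256 * ((1 + ‖x‖) ^ 4)⁻¹ := by
  have hpos : 0 < (1 + ‖x‖) ^ 4 := by positivity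
  have h16 : (0 : ℝ) < 16 ^ k := by positivity
  rw [← div_eq_mul_inv, le_div_iff₀ hpos, inv_mul_le_iff₀ h16]
  have h1 : 1 + ‖x‖ ≤ 2 * 2 ^ (k + 1) := by
    have : (1 : ℝ) ≤ 2 ^ (k + 1) := one_le_pow₀ (by norm_num)
    linarith
  have h16' : ((2 : ℝ) ^ (k + 1)) ^ 4 = 16 ^ (k + 1) := by
    rw [← pow_mul, mul_comm, pow_mul]; norm_num
  calc (1 + ‖x‖) ^ 4 ≤ (2 * 2 ^ (k + 1)) ^ 4 := pow_le_pow_left₀ (by positivity) h1 4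
    _ = 16 ^ k * 256 := by rw [mul_pow, h16', pow_succ]; norm_num; ring

/-- Far sources: if `2^{k+1} ≤ ‖x‖` then `((‖x‖/2)^4)⁻¹ ≤ 16 (16^{k+1})⁻¹`. [folklore] -/
theorem inv_half_norm_pow_four_le {x : EuclideanSpace ℝ (Fin 3)} {k : ℕ}
    (hx : (2 : ℝ) ^ (k + 1) ≤ ‖x‖) : (((‖x‖ / 2) ^ 4))⁻¹ ≤ 16 * ((16 : ℝ) ^ (k + 1))⁻¹ := by
  have h2 : (0 : ℝ) < 2 ^ (k + 1) := by positivity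
  have hxpos : 0 < ‖x‖ := h2.trans_le hx
  have hpos : 0 < (‖x‖ / 2) ^ 4 := by positivity
  have h16 : (0 : ℝ) < 16 ^ (k + 1) := by positivity
  rw [← div_eq_mul_inv, le_div_iff₀ h16, inv_mul_le_iff₀ hpos]
  have h4 : ((2 : ℝ) ^ (k + 1)) ^ 4 ≤ ‖x‖ ^ 4 := pow_le_pow_left₀ h2.le hx 4
  have h16' : ((2 : ℝ) ^ (k + 1)) ^ 4 = 16 ^ (k + 1) := by rw [← pow_mul, mul_comm, pow_mul]; norm_num
  rw [← h16']
  calc ((2 : ℝ) ^ (k + 1)) ^ 4 ≤ ‖x‖ ^ 4 := h4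
    _ = (‖x‖ / 2) ^ 4 * 16 := by ring

/-- The target weight on far points: if `2^{k+1} ≤ ‖x‖` then `(1+‖x‖)^{-4} ≤ (16^{k+1})⁻¹`.
[folklore] -/
theorem one_add_norm_rpow_neg_four_le {x : EuclideanSpace ℝ (Fin 3)} {k : ℕ}
    (hx : (2 : ℝ) ^ (k + 1) ≤ ‖x‖) : (1 + ‖x‖) ^ (-(4 : ℝ)) ≤ ((16 : ℝ) ^ (k + 1))⁻¹ := by
  rw [one_add_rpow_neg_four (norm_nonneg x)]
  have h2 : (0 : ℝ) < 2 ^ (k + 1) := by positivity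
  refine inv_anti₀ (by positivity) ?_
  have h16' : ((2 : ℝ) ^ (k + 1)) ^ 4 = 16 ^ (k + 1) := by rw [← pow_mul, mul_comm, pow_mul]; norm_num
  rw [← h16']
  exact pow_le_pow_left₀ h2.le (by linarith) 4

/-! ### One time window -/

/-- **The window step of the decay bootstrap.** Let `C_B > 0` be a constant of the near/far
bound for the Oseen–Duhamel term (`exists_norm_oseenDuhamel_le_far_add_near`). Let `v` be a field
on the window `(s₀, s₁]`, `s₁ - s₀ ≤ 1`, bounded by `M` with energies `≤ e`, and let the window be
parabolically short: `C_B · 2√(s₁ - s₀) · M ≤ 1/32`. Suppose the free term from base times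
arbitrarily close to `s₀` decays: for every `τ ∈ (s₀,s₁]`, `x`, `ε > 0` there is `s ∈ [s₀, τ)`
with `‖v(τ,x) + B¹_s(v,v)(τ)(x)‖ ≤ C_H A₀ (1 + ‖x‖)⁻⁴ + ε` (`C_H, A₀ ≥ 0`). Then
`‖v(τ,x)‖ ≤ 256 D (1 + ‖x‖)⁻⁴` on `(s₀,s₁] × ℝ³` with `D = max M (2 (C_H A₀ + 16 C_B e))`.
Dyadic induction on `‖x‖ ≥ 2^k` (module docstring). [folklore] -/
theorem decay_window_step {CB : ℝ} (hCB0 : 0 < CB)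
    (hCB : ∀ {a b : ℝ → EuclideanSpace ℝ (Fin 3) → EuclideanSpace ℝ (Fin 3)} {s t : ℝ},
      s ≤ t → ∀ {x : EuclideanSpace ℝ (Fin 3)} {ρ J η : ℝ}, 0 < ρ → 0 ≤ J → 0 ≤ η →
      (∀ τ ∈ Set.Ioo s t, ∫⁻ y, ‖a τ y‖ₑ * ‖b τ y‖ₑ ≤ ENNReal.ofReal J) →
      (∀ τ ∈ Set.Ioo s t, ∀ y, ‖y - x‖ < ρ → ‖a τ y‖ * ‖b τ y‖ ≤ η) →
      ‖oseenDuhamel 1 s a b t x‖ ≤ CB * (t - s) * (ρ ^ 4)⁻¹ * J + CB * (2 * Real.sqrt (t - s)) * η)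
    {v : ℝ → EuclideanSpace ℝ (Fin 3) → EuclideanSpace ℝ (Fin 3)} {s₀ s₁ M e A₀ CH : ℝ}
    (hM : 0 ≤ M) (he : 0 ≤ e) (hA₀ : 0 ≤ A₀) (hCH : 0 ≤ CH)
    (hbd : ∀ σ ∈ Ioc s₀ s₁, ∀ y, ‖v σ y‖ ≤ M)
    (hL2 : ∀ σ ∈ Ioc s₀ s₁, ∫⁻ y, ‖v σ y‖ₑ ^ 2 ≤ ENNReal.ofReal e)
    (hlen : s₁ - s₀ ≤ 1) (hsmall : CB * (2 * Real.sqrt (s₁ - s₀)) * M ≤ 1 / 32)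
    (hrep : ∀ τ ∈ Ioc s₀ s₁, ∀ x, ∀ ε > 0, ∃ s ∈ Ico s₀ τ,
      ‖v τ x + oseenDuhamel 1 s v v τ x‖ ≤ CH * A₀ * (1 + ‖x‖) ^ (-(4 : ℝ)) + ε) :
    ∀ τ ∈ Ioc s₀ s₁, ∀ x, ‖v τ x‖ ≤
      256 * max M (2 * (CH * A₀ + 16 * CB * e)) * (1 + ‖x‖) ^ (-(4 : ℝ)) := by
  set D : ℝ := max M (2 * (CH * A₀ + 16 * CB * e)) with hD
  have hMD : M ≤ D := le_max_left _ _
  have hD0 : 0 ≤ D := hM.trans hMD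
  have hhalf : CH * A₀ + 16 * CB * e ≤ D / 2 := by
    have := le_max_right M (2 * (CH * A₀ + 16 * CB * e)); rw [← hD] at this; linarith
  -- dyadic induction: `2^k ≤ ‖x‖ ⇒ ‖v τ x‖ ≤ D / 16^k`
  have hdyad : ∀ k : ℕ, ∀ τ ∈ Ioc s₀ s₁, ∀ x, (2 : ℝ) ^ k ≤ ‖x‖ → ‖v τ x‖ ≤ D * ((16 : ℝ) ^ k)⁻¹ := by
    intro k
    induction k with
    | zero =>
      intro τ hτ x _
      simpa using (hbd τ hτ x).trans hMD
    | succ k ih =>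
      intro τ hτ x hx
      have h2k : (0 : ℝ) < 2 ^ (k + 1) := by positivity
      have hxpos : 0 < ‖x‖ := h2k.trans_le hx
      set ρ : ℝ := ‖x‖ / 2 with hρ
      have hρ0 : 0 < ρ := by positivity
      -- the Duhamel bound from any base time `s ∈ [s₀, τ)`
      have hB : ∀ s ∈ Ico s₀ τ, ‖oseenDuhamel 1 s v v τ x‖ ≤
          16 * CB * e * ((16 : ℝ) ^ (k + 1))⁻¹ + D / 32 * ((16 : ℝ) ^ k)⁻¹ := by
        intro s hs
        have hst : s ≤ τ := hs.2.le
        have hsub : ∀ σ ∈ Ioo s τ, σ ∈ Ioc s₀ s₁ := fun σ hσ =>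
          ⟨hs.1.trans_lt hσ.1, hσ.2.le.trans hτ.2⟩
        have hint : ∀ σ ∈ Ioo s τ, ∫⁻ y, ‖v σ y‖ₑ * ‖v σ y‖ₑ ≤ ENNReal.ofReal e := by
          intro σ hσ
          have := hL2 σ (hsub σ hσ)
          simpa only [sq] using this
        have hnear : ∀ σ ∈ Ioo s τ, ∀ y, ‖y - x‖ < ρ → ‖v σ y‖ * ‖v σ y‖ ≤ M * (D * ((16 : ℝ) ^ k)⁻¹) := by
          intro σ hσ y hy
          have hy' : (2 : ℝ) ^ k ≤ ‖y‖ := by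
            have h1 : ‖x‖ ≤ ‖y‖ + ‖y - x‖ := by
              have := norm_le_norm_add_norm_sub' x y
              rw [norm_sub_rev] at this
              linarith [norm_sub_le x y, norm_add_le y (x - y), this]
            have h3 : (2 : ℝ) ^ (k + 1) = 2 * 2 ^ k := by rw [pow_succ]; ring
            rw [hρ] at hy; linarith
          exact mul_le_mul (hbd σ (hsub σ hσ) y) (ih σ (hsub σ hσ) y hy') (norm_nonneg _) hM
        have h := hCB hst hρ0 he (by positivity) hint hnear
        refine h.trans ?_
        have hts : τ - s ≤ 1 := by linarith [hs.1, hτ.2]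
        have hts0 : 0 ≤ τ - s := by linarith [hs.2]
        have hsq : Real.sqrt (τ - s) ≤ Real.sqrt (s₁ - s₀) := Real.sqrt_le_sqrt (by linarith [hs.1, hτ.2])
        have hfar : CB * (τ - s) * (ρ ^ 4)⁻¹ * e ≤ 16 * CB * e * ((16 : ℝ) ^ (k + 1))⁻¹ := by
          have h1 : (ρ ^ 4)⁻¹ ≤ 16 * ((16 : ℝ) ^ (k + 1))⁻¹ := inv_half_norm_pow_four_le hx
          calc CB * (τ - s) * (ρ ^ 4)⁻¹ * e ≤ CB * 1 * (16 * ((16 : ℝ) ^ (k + 1))⁻¹) * e := by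
                gcongr
            _ = 16 * CB * e * ((16 : ℝ) ^ (k + 1))⁻¹ := by ring
        have hnr : CB * (2 * Real.sqrt (τ - s)) * (M * (D * ((16 : ℝ) ^ k)⁻¹)) ≤
            D / 32 * ((16 : ℝ) ^ k)⁻¹ := by
          have h1 : CB * (2 * Real.sqrt (τ - s)) * M ≤ 1 / 32 := by
            calc CB * (2 * Real.sqrt (τ - s)) * M ≤ CB * (2 * Real.sqrt (s₁ - s₀)) * M := by gcongr
              _ ≤ 1 / 32 := hsmall
          have hDk : 0 ≤ D * ((16 : ℝ) ^ k)⁻¹ := by positivity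
          calc CB * (2 * Real.sqrt (τ - s)) * (M * (D * ((16 : ℝ) ^ k)⁻¹))
              = (CB * (2 * Real.sqrt (τ - s)) * M) * (D * ((16 : ℝ) ^ k)⁻¹) := by ring
            _ ≤ 1 / 32 * (D * ((16 : ℝ) ^ k)⁻¹) := mul_le_mul_of_nonneg_right h1 hDk
            _ = D / 32 * ((16 : ℝ) ^ k)⁻¹ := by ring
        linarith
      -- pass to the limit `ε → 0` through the representation hypothesis
      have hW : (1 + ‖x‖) ^ (-(4 : ℝ)) ≤ ((16 : ℝ) ^ (k + 1))⁻¹ := one_add_norm_rpow_neg_four_le hx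
      refine le_of_forall_pos_le_add fun ε hε => ?_
      obtain ⟨s, hs, hsrep⟩ := hrep τ hτ x ε hε
      have hkey : ‖v τ x‖ ≤ ‖v τ x + oseenDuhamel 1 s v v τ x‖ + ‖oseenDuhamel 1 s v v τ x‖ := by
        have := norm_sub_le (v τ x + oseenDuhamel 1 s v v τ x) (oseenDuhamel 1 s v v τ x)
        rwa [add_sub_cancel_right] at this
      have h16k : ((16 : ℝ) ^ (k + 1))⁻¹ = ((16 : ℝ) ^ k)⁻¹ / 16 := by
        rw [pow_succ, mul_inv, div_eq_mul_inv]
      have hCHA : CH * A₀ * (1 + ‖x‖) ^ (-(4 : ℝ)) ≤ CH * A₀ * ((16 : ℝ) ^ (k + 1))⁻¹ :=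
        mul_le_mul_of_nonneg_left hW (by positivity)
      have h16pos : 0 < ((16 : ℝ) ^ k)⁻¹ := by positivity
      calc ‖v τ x‖ ≤ (CH * A₀ * (1 + ‖x‖) ^ (-(4 : ℝ)) + ε) +
            (16 * CB * e * ((16 : ℝ) ^ (k + 1))⁻¹ + D / 32 * ((16 : ℝ) ^ k)⁻¹) :=
            hkey.trans (add_le_add hsrep (hB s hs))
        _ ≤ (CH * A₀ * ((16 : ℝ) ^ (k + 1))⁻¹ + ε) +
            (16 * CB * e * ((16 : ℝ) ^ (k + 1))⁻¹ + D / 32 * ((16 : ℝ) ^ k)⁻¹) := by gcongr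
        _ = (CH * A₀ + 16 * CB * e) * (((16 : ℝ) ^ k)⁻¹ / 16) + D / 32 * ((16 : ℝ) ^ k)⁻¹ + ε := by
            rw [h16k]; ring
        _ ≤ (D / 2) * (((16 : ℝ) ^ k)⁻¹ / 16) + D / 32 * ((16 : ℝ) ^ k)⁻¹ + ε := by gcongr
        _ = D * ((16 : ℝ) ^ (k + 1))⁻¹ + ε := by rw [h16k]; ring
  -- conversion to the weight `(1 + ‖x‖)⁻⁴`
  intro τ hτ x
  rw [one_add_rpow_neg_four (norm_nonneg x)]
  rcases lt_or_ge ‖x‖ 1 with hx1 | hx1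
  · -- `‖x‖ < 1`: the sup bound suffices (`(1+‖x‖)^4 < 16 ≤ 256`)
    have h1 : ((1 + ‖x‖) ^ 4)⁻¹ ≥ (16 : ℝ)⁻¹ := by
      refine inv_anti₀ (by positivity) ?_
      calc (1 + ‖x‖) ^ 4 ≤ (2 : ℝ) ^ 4 := pow_le_pow_left₀ (by positivity) (by linarith) 4
        _ = 16 := by norm_num
    calc ‖v τ x‖ ≤ M := hbd τ hτ x
      _ ≤ D := hMD
      _ = 256 * D * (16 : ℝ)⁻¹ * (1 / 16) := by ring
      _ ≤ 256 * D * ((1 + ‖x‖) ^ 4)⁻¹ * 1 := by gcongr; norm_num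
      _ = 256 * D * ((1 + ‖x‖) ^ 4)⁻¹ := mul_one _
  · obtain ⟨k, hk1, hk2⟩ := exists_nat_pow_near hx1 one_lt_two
    calc ‖v τ x‖ ≤ D * ((16 : ℝ) ^ k)⁻¹ := hdyad k τ hτ x hk1
      _ ≤ D * (256 * ((1 + ‖x‖) ^ 4)⁻¹) :=
          mul_le_mul_of_nonneg_left (inv_sixteen_pow_le_of_norm_lt hk2) hD0
      _ = 256 * D * ((1 + ‖x‖) ^ 4)⁻¹ := by ring

/-! ### Finitely many windows -/

/-- **Spatial decay of the velocity along a bounded finite-energy Oseen-mild field.** Let `v` be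
jointly continuous on `[0,T) × ℝ³`, bounded by `M`, with energies `∫ |v(τ)|² ≤ e`, datum
`|v(0,y)| ≤ A (1+|y|)⁻⁴`, and satisfying the Oseen identity
`v(τ) = e^{(τ-s)Δ}v(s) - B¹_s(v,v)(τ)` for all `0 < s < τ < T`. Then for every `T' < T` there is
`A'` with `|v(τ,x)| ≤ A' (1+|x|)⁻⁴` on `[0,T'] × ℝ³`. Proof: windows of a fixed parabolically
small length `δ = δ(C_B, M)` (`decay_window_step`), finitely many of which cover `[0,T']`; on the
first window the free term is controlled through the continuity of `s ↦ e^{(τ-s)Δ}v(s)(x)` at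
`s = 0⁺` (`tendsto_heatExtension_sub_nhdsWithin_zero`), on the later ones through the identity
from the base time; in both cases it decays by `exists_norm_heatExtension_le_of_decay`.
(Brandolese 2004, §2; Miyakawa 2002.) [folklore] -/
theorem exists_decay_velocity_of_oseenMild
    {v : ℝ → EuclideanSpace ℝ (Fin 3) → EuclideanSpace ℝ (Fin 3)} {T M e A : ℝ}
    (hM : 0 ≤ M) (he : 0 ≤ e) (hA : 0 ≤ A)
    (hcont : ContinuousOn (uncurry v) (Ico 0 T ×ˢ univ))
    (hbd : ∀ σ ∈ Ico 0 T, ∀ y, ‖v σ y‖ ≤ M)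
    (hL2 : ∀ σ ∈ Ico 0 T, ∫⁻ y, ‖v σ y‖ₑ ^ 2 ≤ ENNReal.ofReal e)
    (hdat : ∀ y, ‖v 0 y‖ ≤ A * (1 + ‖y‖) ^ (-(4 : ℝ)))
    (hmild : ∀ ⦃s τ : ℝ⦄, 0 < s → s < τ → τ < T → ∀ x,
      v τ x = heatExtension (v s) (τ - s) x - oseenDuhamel 1 s v v τ x) :
    ∀ T' < T, ∃ A' : ℝ, 0 ≤ A' ∧
      ∀ τ ∈ Icc 0 T', ∀ x, ‖v τ x‖ ≤ A' * (1 + ‖x‖) ^ (-(4 : ℝ)) := by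
  intro T' hT'T
  rcases lt_or_ge T' 0 with hT'neg | hT'0
  · exact ⟨0, le_rfl, fun τ hτ => absurd (hτ.1.trans hτ.2) (not_le.2 hT'neg)⟩
  have hT : 0 < T := hT'0.trans_lt hT'T
  obtain ⟨CB, hCB0, hCB⟩ := exists_norm_oseenDuhamel_le_far_add_near
  obtain ⟨CH, hCH0, hCH⟩ := exists_norm_heatExtension_le_of_decay
    (E := EuclideanSpace ℝ (Fin 3)) (F := EuclideanSpace ℝ (Fin 3)) 4 one_pos
  have hCH' : ∀ {g : EuclideanSpace ℝ (Fin 3) → EuclideanSpace ℝ (Fin 3)} {A₀ : ℝ}, 0 ≤ A₀ →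
      (∀ y, ‖g y‖ ≤ A₀ * (1 + ‖y‖) ^ (-(4 : ℝ))) → ∀ {t : ℝ}, 0 < t → t ≤ 1 → ∀ x,
        ‖heatExtension g t x‖ ≤ CH * A₀ * (1 + ‖x‖) ^ (-(4 : ℝ)) := by
    intro g A₀ hA₀ hg t ht ht1 x
    have hg' : ∀ y, ‖g y‖ ≤ A₀ * (1 + ‖y‖) ^ (-((4 : ℕ) : ℝ)) := by simpa using hg
    simpa using hCH hA₀ hg' ht ht1 x
  -- the window length
  set M₁ : ℝ := max M 1 with hM₁
  have hM₁1 : 1 ≤ M₁ := le_max_right _ _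
  have hMM₁ : M ≤ M₁ := le_max_left _ _
  set δ : ℝ := min 1 ((1 / (64 * CB * M₁)) ^ 2) with hδ
  have hδ0 : 0 < δ := lt_min one_pos (by positivity)
  have hδ1 : δ ≤ 1 := min_le_left _ _
  have hsmall : CB * (2 * Real.sqrt δ) * M ≤ 1 / 32 := by
    have h1 : Real.sqrt δ ≤ 1 / (64 * CB * M₁) := by
      rw [Real.sqrt_le_left (by positivity)]
      exact min_le_right _ _
    calc CB * (2 * Real.sqrt δ) * M ≤ CB * (2 * (1 / (64 * CB * M₁))) * M₁ := by gcongr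
      _ = 1 / 32 := by field_simp; ring
  -- induction on the number of windows
  have hwin : ∀ j : ℕ, ∃ Aj : ℝ, 0 ≤ Aj ∧
      ∀ τ ∈ Icc 0 (min ((j : ℝ) * δ) T'), ∀ x, ‖v τ x‖ ≤ Aj * (1 + ‖x‖) ^ (-(4 : ℝ)) := by
    intro j
    induction j with
    | zero =>
      refine ⟨A, hA, fun τ hτ x => ?_⟩
      have hτ0 : τ = 0 := by
        have h1 : min ((0 : ℕ) * δ) T' = 0 := by simp [min_eq_left hT'0]
        rw [h1] at hτ; exact le_antisymm hτ.2 hτ.1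
      rw [hτ0]; exact hdat x
    | succ j ih =>
      obtain ⟨Aj, hAj0, hAj⟩ := ih
      set s₀ : ℝ := min ((j : ℝ) * δ) T' with hs₀
      set s₁ : ℝ := min (((j + 1 : ℕ) : ℝ) * δ) T' with hs₁
      have hs₀0 : 0 ≤ s₀ := le_min (by positivity) hT'0
      have hs₀1 : s₀ ≤ s₁ := by
        refine min_le_min ?_ le_rfl
        push_cast; nlinarith
      have hs₁T' : s₁ ≤ T' := min_le_right _ _
      have hlen : s₁ - s₀ ≤ δ := by
        have h1 : s₁ ≤ ((j : ℝ) * δ + δ) ⊓ T' := by rw [hs₁]; push_cast; ring_nf; exact le_rfl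
        have h2 : ((j : ℝ) * δ + δ) ⊓ T' ≤ s₀ + δ := by
          rw [hs₀]
          rcases le_total ((j : ℝ) * δ) T' with h | h
          · rw [min_eq_left h]; exact min_le_left _ _
          · rw [min_eq_right h]; exact (min_le_right _ _).trans (by linarith)
        linarith
      set A₀ : ℝ := max Aj A with hA₀
      have hA₀0 : 0 ≤ A₀ := hA.trans (le_max_right _ _)
      -- hypotheses of the window step on `(s₀, s₁]`
      have hsub : ∀ σ ∈ Ioc s₀ s₁, σ ∈ Ico 0 T := fun σ hσ =>
        ⟨hs₀0.trans hσ.1.le, (hσ.2.trans hs₁T').trans_lt hT'T⟩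
      have hbd' : ∀ σ ∈ Ioc s₀ s₁, ∀ y, ‖v σ y‖ ≤ M := fun σ hσ => hbd σ (hsub σ hσ)
      have hL2' : ∀ σ ∈ Ioc s₀ s₁, ∫⁻ y, ‖v σ y‖ₑ ^ 2 ≤ ENNReal.ofReal e := fun σ hσ =>
        hL2 σ (hsub σ hσ)
      have hsmall' : CB * (2 * Real.sqrt (s₁ - s₀)) * M ≤ 1 / 32 := by
        calc CB * (2 * Real.sqrt (s₁ - s₀)) * M ≤ CB * (2 * Real.sqrt δ) * M := by
              gcongr
          _ ≤ 1 / 32 := hsmall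
      have hrep : ∀ τ ∈ Ioc s₀ s₁, ∀ x, ∀ ε > 0, ∃ s ∈ Ico s₀ τ,
          ‖v τ x + oseenDuhamel 1 s v v τ x‖ ≤ CH * A₀ * (1 + ‖x‖) ^ (-(4 : ℝ)) + ε := by
        intro τ hτ x ε hε
        have hτT : τ < T := (hτ.2.trans hs₁T').trans_lt hT'T
        have hτs₀ : τ - s₀ ≤ 1 := by linarith [hτ.2]
        rcases eq_or_lt_of_le hs₀0 with h0 | h0
        · -- base time `0`: continuity of the caloric term
          have hτ0 : 0 < τ := by rw [h0]; exact hτ.1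
          have hτ1 : τ ≤ 1 := by linarith [hτ.2]
          have hlim := tendsto_heatExtension_sub_nhdsWithin_zero hcont hbd hτ0 hτT x
          have hL : ‖heatExtension (v 0) τ x‖ ≤ CH * A₀ * (1 + ‖x‖) ^ (-(4 : ℝ)) := by
            refine (hCH' hA hdat hτ0 hτ1 x).trans ?_
            gcongr; exact le_max_right _ _
          have hev : ∀ᶠ s in 𝓝[>] (0 : ℝ), ‖heatExtension (v s) (τ - s) x‖ <
              CH * A₀ * (1 + ‖x‖) ^ (-(4 : ℝ)) + ε :=
            (hlim.norm).eventually (Iio_mem_nhds (by linarith))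
          obtain ⟨s, hs1, hs2⟩ := (hev.and (Ioo_mem_nhdsGT hτ0)).exists
          refine ⟨s, ⟨by rw [← h0]; exact hs2.1.le, hs2.2⟩, ?_⟩
          have hid := hmild hs2.1 hs2.2 hτT x
          rw [hid, sub_add_cancel]
          exact hs1.le
        · -- positive base time: the identity from `s₀`
          refine ⟨s₀, ⟨le_rfl, hτ.1⟩, ?_⟩
          have hid := hmild h0 hτ.1 hτT x
          rw [hid, sub_add_cancel]
          have hdat₀ : ∀ y, ‖v s₀ y‖ ≤ A₀ * (1 + ‖y‖) ^ (-(4 : ℝ)) := fun y =>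
            (hAj s₀ ⟨hs₀0, le_rfl⟩ y).trans (by gcongr; exact le_max_left _ _)
          have := hCH' hA₀0 hdat₀ (sub_pos.2 hτ.1) hτs₀ x
          linarith
      have hstep := decay_window_step hCB0 (fun hst => hCB hst) hM he hA₀0 hCH0.le hbd' hL2'
        (hlen.trans hδ1) hsmall' hrep
      set Anew : ℝ := 256 * max M (2 * (CH * A₀ + 16 * CB * e)) with hAnew
      have hAnew0 : 0 ≤ Anew := by positivity
      refine ⟨max Aj Anew, hAj0.trans (le_max_left _ _), fun τ hτ x => ?_⟩
      rcases le_or_gt τ s₀ with h | h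
      · exact (hAj τ ⟨hτ.1, h⟩ x).trans (by gcongr; exact le_max_left _ _)
      · exact (hstep τ ⟨h, hτ.2⟩ x).trans (by gcongr; exact le_max_right _ _)
  -- enough windows to reach `T'`
  obtain ⟨Aj, hAj0, hAj⟩ := hwin ⌈T' / δ⌉₊
  refine ⟨Aj, hAj0, fun τ hτ x => hAj τ ⟨hτ.1, ?_⟩ x⟩
  refine le_min ?_ hτ.2
  have h1 : T' / δ ≤ ⌈T' / δ⌉₊ := Nat.le_ceil _
  rw [div_le_iff₀ hδ0] at h1
  exact hτ.2.trans h1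

/-- **Spatial decay of the velocity along a bounded finite-energy Oseen-mild field (registered
form).** [folklore] -/
theorem exists_decay_velocity_of_oseenMild' :
    ∀ {v : ℝ → EuclideanSpace ℝ (Fin 3) → EuclideanSpace ℝ (Fin 3)} {T M e A : ℝ}, 0 ≤ M → 0 ≤ e →
      0 ≤ A → ContinuousOn (Function.uncurry v) (Set.Ico 0 T ×ˢ Set.univ) →
      (∀ σ ∈ Set.Ico 0 T, ∀ y, ‖v σ y‖ ≤ M) →
      (∀ σ ∈ Set.Ico 0 T, ∫⁻ y, ‖v σ y‖ₑ ^ 2 ≤ ENNReal.ofReal e) →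
      (∀ y, ‖v 0 y‖ ≤ A * (1 + ‖y‖) ^ (-(4 : ℝ))) →
      (∀ ⦃s τ : ℝ⦄, 0 < s → s < τ → τ < T → ∀ x, v τ x =
        Literature.Analysis.UnboundedOperators.heatExtension (v s) (τ - s) x -
          Literature.Analysis.FluidPDE.oseenDuhamel 1 s v v τ x) →
      ∀ T' < T, ∃ A' : ℝ, 0 ≤ A' ∧ ∀ τ ∈ Set.Icc 0 T', ∀ x,
        ‖v τ x‖ ≤ A' * (1 + ‖x‖) ^ (-(4 : ℝ)) :=
  fun hM he hA hcont hbd hL2 hdat hmild =>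
    exists_decay_velocity_of_oseenMild hM he hA hcont hbd hL2 hdat hmild

end Summit.NavierStokesRegularity.NavierStokesRegularity.Theorems.PlanarEnergyAPriori

end
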